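import Literature.NumberTheory.EllipticCurves.AnticyclotomicSignedHeegnerClasses
import HarnessLib

/-!
# Castella–Wan's signed Heegner classes WITHOUT the class-number hypothesis: the setting `Setting₀`
# (no `p ∤ h_K`), the unramified shift `δ` (MS p. 18 / p. 20 / p. 25), `δ`-shifted Heegner families,
# and Prop. 4.4 + Def. 4.5 (§4.1) at general `δ` as ONE statement-only named fact

Topic `Literature/NumberTheory/EllipticCurves`; namespace `Literature.NumberTheory.EllipticCurves.AcSigned`
(the object namespace of `AnticyclotomicSignedSelmer.lean`, `AnticyclotomicSignedCompactSelmer.lean`,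
`AnticyclotomicSignedHeegnerClasses.lean`, which this file continues WITHOUT touching them).  Cell
`pub/bsd-ssimc`, literature-typer row (xiv) `bsd-ssimc-ty-acsignedGeneral` (director-bsd (424)D,
2026-08-29: "restate `AcSigned.Setting` WITHOUT `not_dvd_classNumber` per Castella–Wan 2024 Thm A.4 /
§4 δ-shift / Prop 4.4 … the narrowing is the tree's own TODO"), context: the SHARED registered stub
`stub_xAcTorsionSS_classDvd` ("TS1 ∣ {p ∣ h_K}") of the cruxes `TwoVariableEulerSystemDivisibility`
(stmt-BirchSwinnertonDyer-20728) and `AnticyclotomicEisensteinDivisibility` (stmt-BirchSwinnertonDyer-20727).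
HONEST FRAMING: DEFINITIONS with bodies (a `Prop` structure, a predicate pinning `δ`, a shifted-family
structure, two predicates) + PROVED bridge / unfolding / uniqueness lemmas + ONE statement-only named
fact (`def … : Prop`, D-0014; hypotheses as printed — `p > 3` VERBATIM —, specialised as documented;
nothing asserted, no `_holds`, no instance, no notation).  This file executes the part of the tree's
`TODO(general form)` (flags `tot-ram-via-h_K` of `AnticyclotomicSignedSelmer.lean`, `delta-zero` of
`AnticyclotomicSignedHeegnerClasses.lean`) that is printed WITHOUT local signed conditions (§4.1); it
does NOT close the stub (see "NOT in this file") — that is done, at any class number and any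
conductor, by the refereed [CastellaEtAl2025, Prop. 2.5] (`CastellaHsuKunduLeeLiu2025.prop25_XAc_isTorsion`,
typed by the same seat).  Typed ≠ proved ≠ endorsed; BSD is not advanced by this file; the cruxes stay
open.

## What is typed here

1. (Part 1) `Setting₀ W K p κ 𝔭 𝔭'` = `AcSigned.Setting` MINUS its last field `not_dvd_classNumber`
   (`E/ℚ` elliptic, `p` odd good supersingular with `a_p = 0`, `K` imaginary quadratic, `p = 𝔭𝔭'`
   split, `κ` anticyclotomic) — exactly Castella–Wan's §4/§6 standing hypotheses minus (gen-H) and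
   `p > 3` (which the facts carry as binders); PROVED bridges `Setting.toSetting₀`,
   `Setting₀.toSetting (h : ¬ p ∣ h_K)`, `setting_iff`.
2. (Part 2) `ZpExtension.IsRingClassShift κ jbar δ`: the non-negative integer `δ` of MS p. 18 /
   p. 20 ("`Cor_n` … for `K[Sp^{n+1−δ}]/K^ac_n[S]`"), PINNED by the ring class containments it is used
   through: for all `n` and `m ≥ 1`, `K^ac_n ⊆ K[p^m] ⟺ n + 1 ≤ m + δ` (subgroups of `Γ_K`:
   `ringClassSubgroup K (p^m) jbar ≤ κ.layerSubgroup n`); PROVED: `K^ac_n ⊆ K[p^{n+1−δ}]` for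
   `n ≥ δ` (`ringClassSubgroup_le`), `K^ac_n ⊆ K[p] ⟺ n ≤ δ` (`le_layerSubgroup_iff_le`), uniqueness
   of `δ` (`unique`).  `δ = 0` when `p ∤ h_K` (printed); in general `p^δ = [K^ac_∞ ∩ H_K : K]`
   (§6.1's `M`, flag `delta-vs-M`).
3. (Part 3) `HeegnerFamilyShift N W K κ jbar δ`: the `δ`-SHIFTED Heegner family — a parametrisation
   datum, an orientation, and norm points `z j = Norm_{K[p^{j+1−δ}]/K_j} P[p^{j+1−δ}] ∈ E(K_j)` for
   `j ≥ δ` (`IsHeegnerNormPoint … j (p^(j+1-δ)) (z j)`), i.e. the points `Cor_n(z[p^{n+1−δ}])` of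
   Prop. 4.4 before the Kummer map; `HeegnerFamilyShift.ofFamily : HeegnerFamily … → HeegnerFamilyShift
   … 0` (the tree's family IS the `δ = 0` family, `rfl` on points); the trace-coherence predicate
   `HeegnerFamilyShift.IsTraceCoherentApZero` (`Tr_{K_{n+2}/K_{n+1}} z_{n+2} = −z_n`, `n ≥ δ`; from
   (4.1)) and the pinning predicate `IsSignedHeegnerClassShift p κ γ F ε z` (Prop. 4.4 / Def. 4.5 /
   p. 22 at general `δ`: for `n ≥ δ` of parity `ε`, the `(n, m)`-component of `ω̃^{-ε}_n(γ − 1)·z` is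
   `(-1)^{⌊(n+1)/2⌋}·δ_{K_n}(z_n)`), with the PROVED `δ = 0` bridges
   `isTraceCoherentApZero_ofFamily_iff`, `isSignedHeegnerClassShift_ofFamily_iff` to the predicates of
   `AnticyclotomicSignedHeegnerClasses.lean`.
4. (Part 4) ONE NAMED FACT `castellaWan2024_prop44_exists_signedHeegnerClass_shift`: Prop. 4.4 +
   Def. 4.5 + p. 22 (corestriction to `K`) at GENERAL `δ`, on the tree's carrier of `H¹(K, 𝐓^ac) =
   lim←_n H¹(K^ac_n, T)` WITHOUT local conditions (`lambdaAdic … (fun _ _ ↦ ⊤)`): for every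
   `Setting₀`, `N = N_E` with the classical Heegner hypothesis, `3 < p`, topological generator `γ`,
   shift `δ` with `IsRingClassShift`, trace-coherent `δ`-shifted family and sign, there is a
   norm-compatible family `z ∈ H¹(K, 𝐓^ac)` which IS the `ε`-signed Heegner class of the family.

## Sources, VERBATIM (texts read by this seat 2026-08-29; locators)

* [CastellaWan2023] F. Castella, X. Wan, *Perrin-Riou's main conjecture for elliptic curves at
  supersingular primes*, Math. Ann. 389 (2024) 2595–2636 = authors' accepted MS
  `paper:url-7157bd4f7b88` (https://web.math.ucsb.edu/~castella/Perrin-Riou.pdf, re-fetched by this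
  seat; journal p = MS p + 2594).  §4 (MS p. 17 L33–L36): "Throughout, we let `E/ℚ` be an elliptic
  curve of conductor `N`, with associated newform `f` … We also let `K` be an imaginary quadratic
  field satisfying hypothesis (gen-H) and `p > 3` be a prime of good supersingular reduction for `E`."
  **Prop. 4.1** (p. 18 L1–L8: Heegner points `x_S ∈ E(K[S]) ⊗ ℤ_p`, "`Tr_{K[ℓS]/K[S]}(x_{ℓS}) = a_ℓ x_S
  − x_{S/ℓ}` if `ℓ ∣ S`"); p. 18 L24–L31 "`z[S] ∈ H¹(K[S], T)` the image of `x_S` under the Kummer map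
  … Since `a_p = 0`, letting `Cor^{n+1}_n` denote the corestriction map for the extension
  `K[Sp^{n+1}]/K[Sp^n]`, the norm-compatibility in Proposition 4.1 yields **(4.1)** `Cor^{n+1}_n(
  z[Sp^{n+1}]) = −z[Sp^{n−1}]` for all `n > 0`"; p. 18 L32–L62: "The anticyclotomic `ℤ_p`-extension
  `K^ac_∞/K` is contained in `K[p^∞] = ∪_{k≥0} K[p^k]`, and the Galois group `Gal(K[p^∞]/K)` decomposes
  as `Gal(K[p^∞]/K) ≃ Γ^ac × Δ` with `Δ = Gal(K[p^∞]/K)_tors` a finite group. Let `L ⊂ K[p^∞]` be the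
  fixed field of `Γ^ac` and for each `n` let `L_{n+1}` be the subfield of `K[p^∞]` fixed by
  `(Γ^ac)^{p^n}`. Then (4.2) `Γ̃_n := Gal(L_{n+1}/K) ≃ Δ × Gal(K^ac_n/K)`, where `K^ac_n` is the
  subextension of `K^ac_∞` of degree `p^n` over `K`. Note that there exists a non-negative integer
  `δ` such that `L_{n+1+δ} = K[p^n]` for `n ≫ 0`, with `δ = 0` when the class number of `K` is
  coprime to `p`."; §4.1 p. 19 L43–L44 "we identify `Λ^ac` with the one variable power series ring
  `ℤ_p⟦Y⟧` setting `Y = γ^ac − 1`"; **Lemma 4.2** (p. 19; "`z[Sp^n]` lies in the image of `H¹(K[S],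
  𝐓̃) → H¹(K[Sp^n], T)`"); **Lemma 4.3** (pp. 19–20; "`H¹(K[S], 𝐓^ac)` is free over `Λ^ac`", via
  Lemma 6.6, `p > 3`); p. 20 L27–L28 "To ease notation, in the next result we let `Cor_n` be the
  corestriction map for `K[Sp^{n+1−δ}]/K^ac_n[S]`."; **Prop. 4.4** (p. 20 L29–L37) "Let `ε = (−1)^n`.
  There exists a unique class (4.5) `z_n[S]^ε ∈ H¹(K[S], 𝐓^ac)/ω^ε_n(Y)H¹(K[S], 𝐓^ac)` such that
  `ω̃^{−ε}_n(Y) z_n[S]^ε = Cor_n(z[Sp^{n+1−δ}])`. Moreover, the sequences `{(−1)^{n/2} z_n[S]^+}_{n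
  even}`, `{(−1)^{(n+1)/2} z_n[S]^−}_{n odd}` are compatible under the natural maps `H¹(K[S],
  𝐓^ac)/ω^ε_n(Y)H¹(K[S], 𝐓^ac) → H¹(K[S], 𝐓^ac)/ω^ε_{n−2}(Y)H¹(K[S], 𝐓^ac)`"; **Def. 4.5** (p. 21
  L14–L21) "For every sign `ε ∈ {±}` and positive integer `S` prime to `Np` we define the `ε`-Heegner
  point of conductor `S` to be the class `z_∞[S]^ε ∈ H¹(K[S], 𝐓^ac)` given by `z_∞[S]^ε :=
  {z_n[S]^ε}_n ∈ lim←_n H¹(K[S], 𝐓^ac)/ω^ε_n(Y)H¹(K[S], 𝐓^ac) ≃ H¹(K[S], 𝐓^ac)`, where the limit is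
  over the positive integers `n` of parity `ε`"; §4.2 (p. 21 L23–L40): "(spl) `(p) = 𝔭𝔭̄` splits in
  `K` … Let `v` be a prime of `K` above `p`, and let `v₁, …, v_{p^t}` be the primes of `K^ac_∞` lying
  above `v` … let `γ₁ = id, γ₂, …, γ_{p^t} ∈ Γ^ac` be such that `v_i = γ_i v₁`", **Def. 4.6** "Let
  `H¹_±(K_v, 𝐓^ac_{v₁})` be the image of `H¹_±(K_v, 𝐓_{v₁}) ≃ H¹_±(ℚ_p, 𝐓_𝔭)` under the map induced
  by the projection `Γ ↠ Γ^ac`, and set (4.6) `H¹_±(K_v, 𝐓^ac) := ⊕_{i=1}^{p^t} γ_i.H¹_±(K_v,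
  𝐓^ac_{v₁})`"; p. 22 L1–L2 "Let `z^±_∞ ∈ H¹(K, 𝐓^ac)` denote the image of the class `z_∞[1]^±`
  under the corestriction map `H¹(K[1], 𝐓^ac) → H¹(K, 𝐓^ac)`"; **Lemma 4.7** (p. 22) "For each prime
  `v` of `K` above `p` we have `loc_v(z^±_∞) ∈ H¹_±(K_v, 𝐓^ac)`"; §6 (p. 25 L9–L12) "`p > 3` a prime
  of good supersingular reduction for `E`, and `K` an imaginary quadratic field satisfying hypotheses
  (gen-H) and (spl)"; **§6.1** (p. 25 L17–L33) "Let `H_K` be the Hilbert class field of `K`, let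
  `L₀ := K^ac_∞ ∩ H_K`, and denote by `L_m` the subextension of `K^ac_∞` with `[L_m : L₀] = p^m` (so
  `L_m = K^ac_{m+M}` for some fixed `M ≥ 0`). … Letting `p^a` be the inertial degree of `v₁ ∩ L₀`
  over `v`, we have `L_{m,v₁} ⊂ k_{m+a,m}`. Set `a^±_m := Cor_{k_{m+a,m}/L_{m,v₁}}(b̃^±_{m+a,m}) ∈
  H¹_±(L_{m,v₁}, T)` … `a^± = {a^±_m}_m ∈ lim←_m H¹_±(K^ac_{m,v₁}, T) ≃ H¹_±(K_v, 𝐓^ac_{v₁})`";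
  App. A (p. 35 L65–L70) **Thm. A.4** "There exists a collection of cohomology classes `κ^± = {κ^±_n
  ∈ H¹(K, 𝐓^ac/I_S𝐓^ac)}_{n ∈ 𝒩}` with `κ^±_1 = z^±_∞` such that `p^d·κ^± := {p^d·κ^±_n}_{n ∈ 𝒩} ∈
  KS(𝐓^ac, 𝓕_±, 𝓛)`"; (p. 35 L77 – p. 36 L5) **Thm. A.5** "Assume that `N` is squarefree. Then …"
  (quoted in `AnticyclotomicSignedHeegnerClasses.lean`).  NO class-number hypothesis anywhere in §4,
  §6, App. A.
* [Howard2004HeegnerKolyvagin] B. Howard, Compos. Math. 140 (2004), §3.3 (under `p ∤ h_K`: "`K_k` is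
  the maximal `p`-power subextension of `K[p^{k+1}]/K`", `P_k[1] = Norm_{K[p^{k+1}]/K_k[1]} P[p^{k+1}]`)
  — the tree's `HeegnerFamily`, `IsHeegnerNormPoint`, `ringClassSubgroup`, `kummerClassOver`
  (`HeegnerModuleIndex.lean`).
* [Cox2013] D. Cox, *Primes of the form x² + ny²*, Thm. 11.1 (`K(j(𝒪_c)) = K[c]`): the tree's
  `ringClassSubgroup K c jbar = Gal(K̄/K[c])`.

## READING FLAGS (informational — where the transcription is a reading, not a printed sentence)

* `delta-containment` (extends `delta-zero` of `AnticyclotomicSignedHeegnerClasses.lean`): the MS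
  sentence "`L_{n+1+δ} = K[p^n]` for `n ≫ 0`" (p. 18) is read through the containment the definition
  of `Cor_n` (p. 20, "the corestriction map for `K[Sp^{n+1−δ}]/K^ac_n[S]`") REQUIRES, `K^ac_n ⊆
  K[p^{n+1−δ}]` for `n ≥ δ`, sharpened to the equivalence `K^ac_n ⊆ K[p^m] ⟺ n + 1 ≤ m + δ` (`m ≥ 1`)
  that pins `δ` (group theory in `Gal(K[p^∞]/K) ≃ Γ^ac × Δ`: `Gal(K[p^∞]/K[p^m]) ≅ p^{m−1}ℤ_p` maps
  onto `(Γ^ac)^{p^{m−1+δ}}` with `p^δ = [K^ac_∞ ∩ H_K : K]`); at `δ = 0` this is Howard's "`K_k` is the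
  maximal `p`-power subextension of `K[p^{k+1}]/K`".  The pinning equivalence is class field theory,
  carried as the HYPOTHESIS `IsRingClassShift` (nothing about ring class fields is proved here).
* `delta-vs-M`: the `δ` of §4.1 and the `M` of §6.1 ("`L_m = K^ac_{m+M}`", `L₀ = K^ac_∞ ∩ H_K`) are
  both determined by `[K^ac_∞ ∩ H_K : K] = p^δ = p^M`; the MS does not display `δ = M`.
* `CW24-sign`, `coherent-family`, `Shapiro`/`Y-action`, `lim-m`, `N⁻ = 1` (classical Heegner
  hypothesis `SatisfiesHeegnerHypothesis N K` and the modular curve `X₀(N)` in place of (gen-H) with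
  Shimura curves; TODO(general form)), `heegner-normalisation` (`x_S ∈ E(K[S]) ⊗ ℤ_p` of Prop. 4.1 vs
  the tree's Heegner points): inherited verbatim from `AnticyclotomicSignedHeegnerClasses.lean`; for
  the shifted family "`Cor_n ∘ Kummer = Kummer ∘ Norm`" reads `Cor_{K[p^{n+1−δ}]/K_n}(z[p^{n+1−δ}]) =
  δ_{K_n}(Norm_{K[p^{n+1−δ}]/K_n} x_{p^{n+1−δ}})`, and the coherence `Tr_{K_{n+2}/K_{n+1}} z_{n+2} =
  −z_n` (`n ≥ δ`) follows from (4.1) with `K_{n+1}K[p^{n+1−δ}] = K[p^{n+2−δ}]`, `K[p^{n+1−δ}] ∩ K^ac_∞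
  = K_n` — part of the reading, as in the `δ = 0` file.

## NOT in this file (and why) — the honest residue of "restate `Setting` without `not_dvd_classNumber`"

* **Lemma 4.7 (`z^±_∞ ∈ Sel_±(K, 𝐓^ac)`), Thm. A.4, Thm. A.5, Lemma 6.7, Thm. 6.8 at general `δ` are
  NOT typed**, for a reason of faithfulness, not of cost: when `δ > 0` the primes `v ∣ p` are
  UNRAMIFIED in `K^ac_δ = K^ac_∞ ∩ H_K` and totally ramified above it (so "`p ∤ h_K` ⟹ total
  ramification" becomes "`δ = 0` ⟺ total ramification"), `v` has `p^t ≤ p^δ` primes `v_i` above it in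
  `K^ac_∞`, and Castella–Wan's signed local condition is Def. 4.6's `⊕_{i ≤ p^t} γ_i·H¹_±(K_v,
  𝐓^ac_{v₁})` built in §6.1 from the TWO-VARIABLE classes `b^±_{m+a,m}` over `k_{m+a,m}` (unramified
  level `m + a`, ramified level `m`; `p^a` the inertial degree of `v₁ ∩ L₀`).  The tree's signed
  carriers (`condAbove … (.sgn ε)`, `condAboveTorsion`, `selmerTorsion`, `selmerLambdaAdic … (sgn ε)`,
  `X … (sgn ε)` of the sibling files) impose Kobayashi/B.-D. Kim trace conditions indexed by the
  GLOBAL layer `n` of `K^ac_n` at one chosen place and its conjugates; their identity with Def. 4.6 is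
  already a reading at `δ = 0` (flag `CW24-local-condition`) and has NO printed support when the local
  tower `K^ac_{∞,v_i}/ℚ_p` has an unramified bottom of `p^a` layers (`a > 0`): there the layer-indexed
  trace conditions and their parities differ from B.-D. Kim's (indexed from the unramified base) and
  from §6.1's corestrictions.  A faithful general-`δ` typing of Lemma 4.7 / A.5 / 6.8 therefore needs
  a NEW local carrier for (4.6) first (TODO(general form): `signedLocalLambdaAdicShift` with the
  `⊕_{i ≤ p^t} γ_i` decomposition and the `k_{m+a,m}`-corestrictions; then `TransferInputs` of
  `AnticyclotomicSignedTransferInputs.lean` without `IsNonsplitIn κ 𝔭`) — several files, not one.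
  Thm. A.4 moreover needs `KS(𝐓^ac, 𝓕_±, 𝓛)` (Howard-style Kolyvagin systems for the SIGNED
  structure; the tree's `Howard2004.CoeffTowerSetting.KolyvaginSystem` carries the ordinary/
  classical structure).  Consequence recorded for the cruxes: on the existing carriers the
  "`Setting₀`" road reaches "TS1 ∣ {p ∣ h_K}" for NO cell; the refereed statement that does, at any
  `N` and any `h_K`, is [CastellaEtAl2025, Prop. 2.5] (`CastellaHsuKunduLeeLiu2025.prop25_XAc_isTorsion`).
* No existence of `z^ε_∞` is proved or assumed outside the named fact; no uniqueness (Lemma 4.2's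
  injectivity on the tree's carriers is not formalised); nothing about ring class fields is proved
  (the `δ`-datum is a hypothesis, flag `delta-containment`).  Conj. 4.8 / 5.2 are conjectures — never
  Literature facts.  No instance, no notation: `Λ`-module structures stay the sibling files' `def`s.
-/

noncomputable section

open scoped Classical

open NumberField IsDedekindDomain Field Polynomial
open Literature.NumberTheory.EllipticCurves Literature.NumberTheory.GaloisRepresentations
open Literature.NumberTheory.EllipticCurves.ModularForms
open Literature.NumberTheory.EllipticCurves.Kobayashi2003
open Literature.NumberTheory.EllipticCurves.IwasawaDual
open WeierstrassCurve (geomTorsion geomPoints)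

universe u

namespace Literature.NumberTheory.EllipticCurves.AcSigned

/-! ## Part 1. The setting WITHOUT the class-number hypothesis -/

section SettingZero

variable (W : WeierstrassCurve ℚ) [W.IsGloballyMinimal] (K : Type) [Field K] [NumberField K]
  (p : ℕ) [Fact p.Prime] (κ : ZpExtension K p) (𝔭 𝔭' : HeightOneSpectrum (𝓞 K))

/-- **The anticyclotomic supersingular setting WITHOUT the class-number / total-ramification
hypothesis** — `AcSigned.Setting` minus its last field `not_dvd_classNumber`: `E/ℚ` elliptic
(globally minimal model `W`, to read `a_p`); `p` ODD of good SUPERSINGULAR reduction with `a_p = 0`;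
`K` imaginary quadratic with `p = 𝔭𝔭'` SPLIT; `κ` THE anticyclotomic `ℤ_p`-extension.  These are
exactly the standing hypotheses of Castella–Wan §4 (MS p. 17: "`E/ℚ` … of conductor `N` … `K` …
satisfying hypothesis (gen-H) and `p > 3` … of good supersingular reduction") and §6 / App. A (MS
p. 25: "(gen-H) and (spl)") MINUS (gen-H) and `p > 3`, which the facts carry as explicit binders
(`SatisfiesHeegnerHypothesis N K` = the case `N⁻ = 1`; `3 < p`); NO class-number hypothesis is printed
in §4, §6 or App. A (MS p. 18: "`δ = 0` when the class number of `K` is coprime to `p`" is the only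
mention).  The tree's `Setting.not_dvd_classNumber` is the printed SUFFICIENT condition for total
ramification of the primes above `p` that Iovita–Pollack (S), B.-D. Kim 2013 §3, Hatley–Lei–Vigni
§1.1 and Longo–Vigni Assumption 1.3 DO print (flag `tot-ram-via-h_K`); facts resting on those sources
keep `Setting`.  A `Prop`-valued structure; nothing is asserted.
[cite: CastellaWan2023, §4 standing hypotheses (MS p. 17 L33–L36), §4.2 (spl) (MS p. 21), §6 (MS p. 25 L9–L12)] -/
structure Setting₀ : Prop where
  /-- `E` is an elliptic curve. -/
  isElliptic : W.IsElliptic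
  /-- `p` is odd. -/
  p_ne_two : p ≠ 2
  /-- good supersingular reduction at `p` (good and `p ∣ a_p`). -/
  goodSS : Rank1Residual.GoodSS W p
  /-- `a_p = 0`. -/
  frobeniusTrace_eq_zero : W.frobeniusTrace p = 0
  /-- `K` is imaginary quadratic. -/
  isImaginaryQuadratic : IsImaginaryQuadratic K
  /-- `𝔭` lies above `p`. -/
  mem : ((p : ℕ) : 𝓞 K) ∈ 𝔭.asIdeal
  /-- `𝔭'` lies above `p`. -/
  mem' : ((p : ℕ) : 𝓞 K) ∈ 𝔭'.asIdeal
  /-- `𝔭' ≠ 𝔭`: `p` splits in `K`. -/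
  ne : 𝔭' ≠ 𝔭
  /-- `κ` is the anticyclotomic `ℤ_p`-extension of `K`. -/
  anticyclotomic : κ.IsAnticyclotomic

variable {W K p κ 𝔭 𝔭'}

/-- **The one-line bridge `Setting → Setting₀`** (forget `p ∤ h_K`).
[cite: CastellaWan2023, §4 standing hypotheses (MS p. 17 L33–L36)] -/
theorem Setting.toSetting₀ (h : Setting W K p κ 𝔭 𝔭') : Setting₀ W K p κ 𝔭 𝔭' :=
  ⟨h.isElliptic, h.p_ne_two, h.goodSS, h.frobeniusTrace_eq_zero, h.isImaginaryQuadratic, h.mem,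
    h.mem', h.ne, h.anticyclotomic⟩

/-- Conversely, `Setting₀` together with `p ∤ h_K` is `Setting`.
[cite: CastellaWan2023, §4.1 (MS p. 18 L61–L62, "`δ = 0` when the class number of `K` is coprime to `p`")] -/
theorem Setting₀.toSetting (h : Setting₀ W K p κ 𝔭 𝔭') (hh : ¬ p ∣ NumberField.classNumber K) :
    Setting W K p κ 𝔭 𝔭' :=
  ⟨h.isElliptic, h.p_ne_two, h.goodSS, h.frobeniusTrace_eq_zero, h.isImaginaryQuadratic, h.mem,
    h.mem', h.ne, h.anticyclotomic, hh⟩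

/-- `Setting` is `Setting₀` plus `p ∤ h_K` (unfolding).
[cite: CastellaWan2023, §4.1 (MS p. 18 L61–L62)] -/
theorem setting_iff_setting₀_and_not_dvd :
    Setting W K p κ 𝔭 𝔭' ↔ Setting₀ W K p κ 𝔭 𝔭' ∧ ¬ p ∣ NumberField.classNumber K :=
  ⟨fun h ↦ ⟨h.toSetting₀, h.not_dvd_classNumber⟩, fun h ↦ h.1.toSetting h.2⟩

end SettingZero

/-! ## Part 2. The unramified shift `δ` (MS pp. 18, 20, 25), pinned by ring class containments -/

section Shift

variable {K : Type u} [Field K] [NumberField K] {p : ℕ} [Fact p.Prime]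

/-- **`δ` is Castella–Wan's shift for the anticyclotomic tower `κ` of `K` at `p`**: the
non-negative integer of MS p. 18 ("there exists a non-negative integer `δ` such that `L_{n+1+δ} =
K[p^n]` for `n ≫ 0`, with `δ = 0` when the class number of `K` is coprime to `p`") as USED on p. 20
("we let `Cor_n` be the corestriction map for `K[Sp^{n+1−δ}]/K^ac_n[S]`", which requires `K^ac_n ⊆
K[p^{n+1−δ}]`), PINNED by the ring class containments (reading flag `delta-containment`): for every
layer `n` and every `m ≥ 1`, `K^ac_n ⊆ K[p^m]` iff `n + 1 ≤ m + δ` — in subgroups of `Γ_K`,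
`Gal(K̄/K[p^m]) = ringClassSubgroup K (p^m) jbar ≤ κ.layerSubgroup n = Gal(K̄/K_n)`.  Equivalently
`p^δ = [K^ac_∞ ∩ H_K : K]` (§6.1, MS p. 25: "`L₀ := K^ac_∞ ∩ H_K` … `L_m = K^ac_{m+M}` for some fixed
`M ≥ 0`"; flag `delta-vs-M`), and `δ = 0` iff the primes above `p` are totally ramified in `K^ac_∞/K`.
A predicate (a HYPOTHESIS on `δ`; the class field theory computing `δ` is not formalised); nothing
asserted. [cite: CastellaWan2023, §4.1 (MS p. 18 L58–L62, p. 20 L27–L28), §6.1 (MS p. 25 L17–L20)]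
[cite: Howard2004HeegnerKolyvagin, §3.3 ("`K_k` is the maximal `p`-power subextension of `K[p^{k+1}]/K`", the case `δ = 0`)] -/
def _root_.Literature.NumberTheory.EllipticCurves.ZpExtension.IsRingClassShift (κ : ZpExtension K p)
    (jbar : AlgebraicClosure K →+* ℂ) (δ : ℕ) : Prop :=
  ∀ n m : ℕ, 1 ≤ m → (ringClassSubgroup K (p ^ m) jbar ≤ κ.layerSubgroup n ↔ n + 1 ≤ m + δ)

variable {κ : ZpExtension K p} {jbar : AlgebraicClosure K →+* ℂ} {δ : ℕ}

/-- Unfolding `IsRingClassShift`. [cite: CastellaWan2023, §4.1 (MS p. 18 L58–L62, p. 20 L27–L28)] -/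
theorem _root_.Literature.NumberTheory.EllipticCurves.ZpExtension.isRingClassShift_iff
    (κ : ZpExtension K p) (jbar : AlgebraicClosure K →+* ℂ) (δ : ℕ) :
    κ.IsRingClassShift jbar δ ↔
      ∀ n m : ℕ, 1 ≤ m → (ringClassSubgroup K (p ^ m) jbar ≤ κ.layerSubgroup n ↔ n + 1 ≤ m + δ) :=
  Iff.rfl

/-- **`K^ac_n ⊆ K[p^{n+1−δ}]` for `n ≥ δ`** — the containment under which Castella–Wan's `Cor_n`
("the corestriction map for `K[Sp^{n+1−δ}]/K^ac_n[S]`", MS p. 20) is defined.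
[cite: CastellaWan2023, §4.1 (MS p. 20 L27–L28)] -/
theorem _root_.Literature.NumberTheory.EllipticCurves.ZpExtension.IsRingClassShift.ringClassSubgroup_le
    (h : κ.IsRingClassShift jbar δ) {n : ℕ} (hn : δ ≤ n) :
    ringClassSubgroup K (p ^ (n + 1 - δ)) jbar ≤ κ.layerSubgroup n :=
  (h n (n + 1 - δ) (by omega)).2 (by omega)

/-- **`K^ac_n ⊆ K[p]` iff `n ≤ δ`**: the first `δ` layers of the anticyclotomic tower lie in `K[p]`
(indeed in the Hilbert class field; §6.1 "`L₀ = K^ac_∞ ∩ H_K`", flag `delta-vs-M`), the later ones do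
not. [cite: CastellaWan2023, §4.1 (MS p. 18 L58–L62), §6.1 (MS p. 25 L17–L20)] -/
theorem _root_.Literature.NumberTheory.EllipticCurves.ZpExtension.IsRingClassShift.le_layerSubgroup_iff_le
    (h : κ.IsRingClassShift jbar δ) (n : ℕ) :
    ringClassSubgroup K (p ^ 1) jbar ≤ κ.layerSubgroup n ↔ n ≤ δ := by
  rw [h n 1 le_rfl]
  omega

/-- **The shift is unique**: two integers satisfying `IsRingClassShift` for the same tower and the
same `jbar` are equal (test the containments at `m = 1`). [cite: CastellaWan2023, §4.1 (MS p. 18 L58–L62)] -/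
theorem _root_.Literature.NumberTheory.EllipticCurves.ZpExtension.IsRingClassShift.unique {δ' : ℕ}
    (h : κ.IsRingClassShift jbar δ) (h' : κ.IsRingClassShift jbar δ') : δ = δ' := by
  have h₁ : δ ≤ δ' := (h'.le_layerSubgroup_iff_le δ).1 ((h.le_layerSubgroup_iff_le δ).2 le_rfl)
  have h₂ : δ' ≤ δ := (h.le_layerSubgroup_iff_le δ').1 ((h'.le_layerSubgroup_iff_le δ').2 le_rfl)
  omega

end Shift

/-! ## Part 3. `δ`-shifted Heegner families, trace coherence, and the pinning predicate -/

section Family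

variable (N : ℕ) [NeZero N] (W : WeierstrassCurve ℚ) (K : Type u) [Field K] [NumberField K]
  {p : ℕ} [Fact p.Prime] (κ : ZpExtension K p) (jbar : AlgebraicClosure K →+* ℂ)

/-- **A `δ`-shifted Heegner family along the anticyclotomic tower** (data + hypotheses): a
parametrisation datum `Dt` and an orientation `β` (`β² ≡ d_K (mod 4N)`), fixed for the family, and
norm points `z j = Norm_{K[p^{j+1−δ}]/K_j} P[p^{j+1−δ}] ∈ E(K_j)` for `j ≥ δ` (`IsHeegnerNormPoint … j
(p^(j+1−δ)) (z j)`: the norm of a Heegner point of conductor `p^{j+1−δ}` over a transversal of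
`Gal(K̄/K_j K[p^{j+1−δ}])` in `Gal(K̄/K_j)`, which is `Norm_{K[p^{j+1−δ}]/K_j}` when `K_j ⊆ K[p^{j+1−δ}]`,
i.e. for the `δ` of `IsRingClassShift`; the values `z j`, `j < δ`, are unconstrained and unused) —
the points whose Kummer images are Castella–Wan's `Cor_n(z[p^{n+1−δ}])` (MS p. 20: "`Cor_n` … the
corestriction map for `K[Sp^{n+1−δ}]/K^ac_n[S]`", at `S = 1` and corestricted `K[1] → K` as on p. 22).
For `δ = 0` this is the tree's `HeegnerFamily` (Howard's `Norm_{K[p^{j+1}]/K_j} P[p^{j+1}]`), see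
`HeegnerFamilyShift.ofFamily`.  Nothing asserted (existence of such families is the CM input
`exists_isHeegnerNormPoint` of `HeegnerModuleIndex.lean`, not restated here).
[cite: CastellaWan2023, Prop. 4.1 and §4.1 (MS p. 18 L1–L31, p. 20 L27–L37, p. 22 L1–L2)]
[cite: Howard2004HeegnerKolyvagin, §3.3] -/
structure HeegnerFamilyShift (δ : ℕ) where
  /-- The modular parametrisation datum (fixes `φ : X₀(N) → E`). -/
  Dt : ModularParametrizationData W N
  /-- The orientation: a residue `β` with `β² ≡ d_K (mod 4N)` (the ideal `𝔫`). -/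
  β : ℤ
  /-- `β² ≡ d_K (mod 4N)`. -/
  dvd_sq_sub : (4 * N : ℤ) ∣ β ^ 2 - NumberField.discr K
  /-- The norm points `z_j ∈ E(K_j)`, of conductor `p^{j+1−δ}` for `j ≥ δ`. -/
  z : ℕ → geomPoints (W.baseChange K)
  /-- `z j = Norm_{K[p^{j+1−δ}]/K_j} P[p^{j+1−δ}]` for `j ≥ δ`. -/
  isHeegnerNormPoint_z : ∀ j, δ ≤ j → IsHeegnerNormPoint N W K κ Dt β jbar j (p ^ (j + 1 - δ)) (z j)

variable {N W K κ jbar}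

namespace HeegnerFamilyShift

/-- **The tree's `HeegnerFamily` is a `0`-shifted family** (same data; `p^{j+1−0} = p^{j+1}`).
[cite: Howard2004HeegnerKolyvagin, §3.3] [cite: CastellaWan2023, §4.1 (MS p. 18 L61–L62, `δ = 0`)] -/
def ofFamily (F : HeegnerFamily N W K κ jbar) : HeegnerFamilyShift N W K κ jbar 0 where
  Dt := F.Dt
  β := F.β
  dvd_sq_sub := F.dvd_sq_sub
  z := F.z
  isHeegnerNormPoint_z j _ := F.isHeegnerNormPoint_z j

/-- The points of `ofFamily F` are those of `F` (`rfl`). [cite: Howard2004HeegnerKolyvagin, §3.3] -/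
@[simp] theorem ofFamily_z (F : HeegnerFamily N W K κ jbar) (j : ℕ) : (ofFamily F).z j = F.z j := rfl

/-- Every norm point `z j`, `j ≥ δ`, is fixed by `Gal(K̄/K_j)` (`IsHeegnerNormPoint.smul_eq_self`).
[cite: Howard2004HeegnerKolyvagin, §3.3] -/
theorem smul_z_eq_self {δ : ℕ} (F : HeegnerFamilyShift N W K κ jbar δ) {j : ℕ} (hj : δ ≤ j)
    {σ : absoluteGaloisGroup K} (hσ : σ ∈ κ.layerSubgroup j) : σ • F.z j = F.z j :=
  (F.isHeegnerNormPoint_z j hj).smul_eq_self hσ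

/-- **Trace-coherence of a shifted family at `a_p = 0`**: `Tr_{K_{n+2}/K_{n+1}}(z_{n+2}) = −z_n` for
all `n ≥ δ`, the traces being sums over a transversal `R ⊆ Gal(K̄/K_{n+1})` of `Gal(K̄/K_{n+2})` (as in
`HeegnerFamily.IsTraceCoherentApZero`, the case `δ = 0`).  This is Castella–Wan's (4.1)
"`Cor^{n+1}_n(z[Sp^{n+1}]) = −z[Sp^{n−1}]` … since `a_p = 0`" for the conductors `p^{n+3−δ} →
p^{n+1−δ}`, traced to the layers (`K_{n+1}K[p^{n+1−δ}] = K[p^{n+2−δ}]`, `K[p^{n+1−δ}] ∩ K^ac_∞ = K_n`;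
flag `coherent-family`); a hypothesis where used, nothing asserted.
[cite: CastellaWan2023, Prop. 4.1 and (4.1) (MS p. 18 L1–L31)] -/
def IsTraceCoherentApZero {δ : ℕ} (F : HeegnerFamilyShift N W K κ jbar δ) : Prop :=
  ∀ n : ℕ, δ ≤ n → ∀ R : Finset (absoluteGaloisGroup K),
    (↑R ⊆ (κ.layerSubgroup (n + 1) : Set (absoluteGaloisGroup K))) →
    (∀ τ ∈ κ.layerSubgroup (n + 1), ∃! r, r ∈ R ∧ r⁻¹ * τ ∈ κ.layerSubgroup (n + 2)) →
      ∑ r ∈ R, r • F.z (n + 2) = -F.z n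

/-- At `δ = 0` the shifted trace-coherence IS the tree's `HeegnerFamily.IsTraceCoherentApZero`.
[cite: CastellaWan2023, (4.1) (MS p. 18)] -/
theorem isTraceCoherentApZero_ofFamily_iff (F : HeegnerFamily N W K κ jbar) :
    (ofFamily F).IsTraceCoherentApZero ↔ F.IsTraceCoherentApZero :=
  ⟨fun h n R hR hT ↦ h n (Nat.zero_le n) R hR hT, fun h n _ R hR hT ↦ h n R hR hT⟩

end HeegnerFamilyShift

variable (p κ) (γ : absoluteGaloisGroup K)

/-- **`z` is the `ε`-signed `Λ^ac`-adic Heegner class of the `δ`-shifted family `F`** (Castella–Wan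
Prop. 4.4 + Def. 4.5 + p. 22 at GENERAL `δ`; the case `δ = 0` is `AcSigned.IsSignedHeegnerClass`):
for every layer `n ≥ δ` of parity `ε` (`(-1)^n = ε`) and every `m`, the level-`(n, m)` component of
`ω̃^{-ε}_n(γ − 1) · z` (the polynomial `omegaTildeOpp p ε n` acting through the truncated action
`tsmul`, i.e. through `Λ^ac = ℤ_p⟦Y⟧`, `Y = γ − 1`) is `(-1)^{⌊(n+1)/2⌋}` times the Kummer class
`δ_{K_n}(z_n) ∈ H¹(K_n, E[p^m])` of the shifted norm point `z_n = Norm_{K[p^{n+1−δ}]/K_n} P[p^{n+1−δ}]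
= F.z n` (`kummerClassOver` at any `p^m`-th root `Q`; the class does not depend on `Q`).  Printed:
"we let `Cor_n` be the corestriction map for `K[Sp^{n+1−δ}]/K^ac_n[S]`. Proposition 4.4. Let `ε =
(−1)^n`. There exists a unique class `z_n[S]^ε ∈ H¹(K[S], 𝐓^ac)/ω^ε_n(Y)H¹(K[S], 𝐓^ac)` such that
`ω̃^{−ε}_n(Y) z_n[S]^ε = Cor_n(z[Sp^{n+1−δ}])`. Moreover, the sequences `{(−1)^{n/2} z_n[S]^+}_{n even}`,
`{(−1)^{(n+1)/2} z_n[S]^−}_{n odd}` are compatible"; Def. 4.5 "`z_∞[S]^ε := {z_n[S]^ε}_n ∈ lim←_n …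
≃ H¹(K[S], 𝐓^ac)`, where the limit is over the positive integers `n` of parity `ε`"; p. 22 "`z^±_∞ ∈
H¹(K, 𝐓^ac)` … the image of the class `z_∞[1]^±` under the corestriction map".  READINGS (flags
`CW24-sign`, `delta-containment`, `coherent-family`): compatible normalisation `(-1)^{⌊(n+1)/2⌋}`;
`K_n ⊆ K[p^{n+1−δ}]`; `Cor ∘ Kummer = Kummer ∘ Norm`.  A predicate on a raw family `z ∈ ∏_n ∏_m
H¹(K_n, E[p^m])`; nothing asserted.
[cite: CastellaWan2023, Prop. 4.4, Def. 4.5 and §4.2 p. 22 (MS p. 20 L27–L37, p. 21 L14–L21, p. 22 L1–L2)] -/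
def IsSignedHeegnerClassShift {δ : ℕ} (F : HeegnerFamilyShift N W K κ jbar δ) (ε : ℤˣ)
    (z : Π n m : ℕ, (W.baseChange K).torsionH1Over ((p : ℤ) ^ m) (κ.layerSubgroup n)) : Prop :=
  ∀ (n : ℕ) (hn : δ ≤ n), (-1 : ℤˣ) ^ n = ε →
    ∀ (m : ℕ) (Q : geomPoints (W.baseChange K)) (hQ : ((p : ℤ) ^ m) • Q = F.z n),
      tsmul (W.baseChange K) p κ γ (omegaTildeOpp p ε n) z n m =
        ((-1 : ℤ) ^ ((n + 1) / 2)) • (W.baseChange K).kummerClassOver (κ.layerSubgroup n)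
          ((p : ℤ) ^ m) Q (fun σ hσ ↦ by rw [hQ]; exact F.smul_z_eq_self hn hσ)

variable {p κ γ}

/-- At `δ = 0` (the tree's `HeegnerFamily` seen as a `0`-shifted family) the shifted pinning
predicate IS `AcSigned.IsSignedHeegnerClass` (same components, same Kummer classes; the extra
hypothesis `0 ≤ n` is vacuous). [cite: CastellaWan2023, Prop. 4.4 and Def. 4.5 (MS pp. 20–21)] -/
theorem isSignedHeegnerClassShift_ofFamily_iff (F : HeegnerFamily N W K κ jbar) (ε : ℤˣ)
    (z : Π n m : ℕ, (W.baseChange K).torsionH1Over ((p : ℤ) ^ m) (κ.layerSubgroup n)) :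
    IsSignedHeegnerClassShift p κ γ (HeegnerFamilyShift.ofFamily F) ε z ↔
      IsSignedHeegnerClass p κ γ F ε z :=
  ⟨fun h n hε m Q hQ ↦ h n (Nat.zero_le n) hε m Q hQ, fun h n _ hε m Q hQ ↦ h n hε m Q hQ⟩

end Family

/-! ## Part 4. Prop. 4.4 + Def. 4.5 at general `δ` (named fact; statement only, `p > 3` VERBATIM) -/

section Facts

variable (N : ℕ) [NeZero N] (W : WeierstrassCurve ℚ) [W.IsGloballyMinimal] (K : Type) [Field K]
  [NumberField K] (p : ℕ) [Fact p.Prime] (κ : ZpExtension K p) (𝔭 𝔭' : HeightOneSpectrum (𝓞 K))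
  (jbar : AlgebraicClosure K →+* ℂ)

/-- **Castella–Wan 2024, Prop. 4.4 + Def. 4.5 (with p. 22): the signed `Λ^ac`-adic Heegner classes
`z^±_∞ ∈ H¹(K, 𝐓^ac)` EXIST, at ANY class number (general shift `δ`).**  Printed: p. 20 "we let
`Cor_n` be the corestriction map for `K[Sp^{n+1−δ}]/K^ac_n[S]`. Proposition 4.4. Let `ε = (−1)^n`.
There exists a unique class `z_n[S]^ε ∈ H¹(K[S], 𝐓^ac)/ω^ε_n(Y)H¹(K[S], 𝐓^ac)` such that `ω̃^{−ε}_n(Y)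
z_n[S]^ε = Cor_n(z[Sp^{n+1−δ}])`. Moreover, the sequences … are compatible" (construction resting on
Lemma 4.2 and Lemma 4.3 "`H¹(K[S], 𝐓^ac)` is free over `Λ^ac`", via Lemma 6.6, `p > 3`); Def. 4.5
"`z_∞[S]^ε := {z_n[S]^ε}_n ∈ lim←_n H¹(K[S], 𝐓^ac)/ω^ε_n(Y)H¹(K[S], 𝐓^ac) ≃ H¹(K[S], 𝐓^ac)`"; p. 22
"Let `z^±_∞ ∈ H¹(K, 𝐓^ac)` denote the image of the class `z_∞[1]^±` under the corestriction map";
p. 18 "there exists a non-negative integer `δ` such that `L_{n+1+δ} = K[p^n]` for `n ≫ 0`, with `δ = 0`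
when the class number of `K` is coprime to `p`".  Standing hypotheses of §4: `E/ℚ` elliptic of
conductor `N`, `K` imaginary quadratic with (gen-H), `p > 3` of good supersingular reduction (so
`a_p = 0`); NO class-number hypothesis.  TRANSCRIBED (special case / readings, flags
`delta-containment`, `coherent-family`, `CW24-sign`, `Shapiro`, `lim-m`, `heegner-normalisation`):
`N⁻ = 1` (classical Heegner hypothesis `SatisfiesHeegnerHypothesis N K`; TODO(general form): (gen-H)
with Shimura curves), `Setting₀` (NO `p ∤ h_K`; (spl) kept though §4.1 does not need it — weaker than
print), `3 < p` verbatim, for every topological generator `γ`, every `jbar`, every shift `δ` with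
`κ.IsRingClassShift jbar δ` (the hypothesis pinning `δ` to the printed one), every TRACE-COHERENT
`δ`-shifted Heegner family `F` of level `N = N_E` and every sign: there is a norm-compatible,
`p_*`-compatible family `z ∈ H¹(K, 𝐓^ac) = lim←_n H¹(K_n, T)` (the tree's `lambdaAdic … (fun _ _ ↦ ⊤)`,
NO local condition) which is the `ε`-signed Heegner class of `F` (`IsSignedHeegnerClassShift`).
WEAKER than print (no uniqueness; membership of `z^±_∞` in `Sel_±(K, 𝐓^ac)` — Lemma 4.7, which needs
the general-`δ` signed local condition of Def. 4.6 — is NOT recorded here, see the module docstring;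
at `δ = 0` under `p ∤ h_K` the sibling fact `castellaWan2024_prop44_exists_signedHeegnerClass` records
it on the tree's signed carrier).  NOT usable at `p = 3` (printed `p > 3`).  Consumers take
`(h : castellaWan2024_prop44_exists_signedHeegnerClass_shift …)`; no `_holds` expected.
[cite: CastellaWan2023, Prop. 4.4, Def. 4.5, §4.1–4.2 (MS p. 18 L58–L62, p. 20 L27–L37, p. 21 L14–L21, p. 22 L1–L2) and §4 standing hypotheses (MS p. 17 L33–L36)] -/
def castellaWan2024_prop44_exists_signedHeegnerClass_shift : Prop :=
  ∀ (_ : Setting₀ W K p κ 𝔭 𝔭'), (W.conductorNorm ℤ : ℕ) = N → SatisfiesHeegnerHypothesis N K →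
    3 < p → ∀ (γ : absoluteGaloisGroup K), κ.IsTopGenerator γ →
    ∀ (δ : ℕ), κ.IsRingClassShift jbar δ →
    ∀ (F : HeegnerFamilyShift N W K κ jbar δ), F.IsTraceCoherentApZero → ∀ ε : ℤˣ,
      ∃ z ∈ lambdaAdic (W.baseChange K) p κ γ (fun _ _ ↦ ⊤),
        IsSignedHeegnerClassShift p κ γ F ε z

end Facts

end Literature.NumberTheory.EllipticCurves.AcSigned

end
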